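import Mathlib
import Literature.NumberTheory.Automorphic.BCDTModularity
import Literature.NumberTheory.Automorphic.CDTTheorem722
import Literature.NumberTheory.EllipticCurves.Szpiro
import Literature.NumberTheory.Automorphic.QuaternionicForms
import Literature.NumberTheory.Automorphic.DefiniteOrderUnitsCardDvd

/-!
# STUB-IDEAS companion · `stub_liftFive` · ideator k2 (FAMILY 2: reshape) · GEN 17

Typed helper statements for `STUB-IDEAS-stub_liftFive-2.md` (GEN 17).  Technique **T-ε — the
DEFINITE AUTOMORPHIC SIDE AT ℓ = 5**: run the `R = T` / patching engine of the lineage (k2 g7–g16)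
with Hecke MODULES `S^D(U, O) = QuaternionicForm D U O` (tree, `QuaternionicForms.lean`) on the
definite quaternion algebra `D = B_{r,∞}`, `r ≠ 5` a multiplicative prime of `W`, instead of
`H¹(X₀(N), O)_𝔪`.  NEW TOOL that exists ONLY at `ℓ = 5` (not at `ℓ = 3`): for EVERY level
`U₀ ⊇ U₁ ⊇` (centre) with `Δ := U₀/U₁` an `ℓ`-group, `S^D(U₁, O)` is a FREE `O[Δ]`-module and
`S^D(U₁)_Δ = S^D(U₀)` with NO "U sufficiently small" / auxiliary-prime device, because every
stabiliser is a quotient of `(x U₀ x⁻¹ ∩ D^×)/{±1} ⊆ O_x^×/{±1}`, of order dividing `12`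
(`Brandt.card_stabilizer_dvd_twentyfour`, PROVED in the tree) and `5 ∤ 24` — Taylor 2006
(Doc. Math., Coates vol.), Lemma 1.1 (`l > 3`) and Lemma 2.3, specialised to `F = ℚ`.

Sections: §F freeness package (pure group theory, Mathlib only; each ≤ 1 prover cycle) ·
§E consumer-side discharge of the regime binder (elementary + landed tree theorems) ·
§R the regime-M re-cut of the stub and its consumer glue (PROVED one-liners).
Sorries: ONLY in helper statements F1–F5b, E1–E3 (ideation seat: statements, not proofs).
-/

open scoped MatrixGroups NumberField BigOperators
open Literature.NumberTheory.EllipticCurves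
open Literature.NumberTheory.EllipticCurves.ModularForms
open Literature.NumberTheory.Automorphic
open Literature.NumberTheory.Automorphic.BCDT
open Literature.NumberTheory.GaloisRepresentations
open WeierstrassCurve IsDedekindDomain

namespace Summit.ABC.ABC.Cruxes.FreyModularity.StubIdeas.LiftFive2g17

/-! ## §F  Freeness package: an `ℓ`-group `Δ = U₀/U₁` acting on `A \ G / U₁` by right translation

Dictionary (A1): `G = finiteAdelicUnits ℚ D`, `A = (inclFinite ℚ D).range`, `U₀ = Ô_N^× ∩ U₀(Q)`,
`U₁ = U_Δ(Q)` (Taylor–Wiles level at the TW set `Q`, condition on `a/d mod q`, so scalars lie in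
`U₁`), `X = DoubleCoset.Quotient A U₁`; `Γ_x := A ∩ x U₀ x⁻¹ ⊆ Stab_{Dˣ}(I_x)`, `I_x = D ∩ x Ô`
a full lattice, so `Nat.card Γ_x ∣ 24` (`Brandt.card_stabilizer_dvd_twentyfour`). -/

section Freeness

variable {G : Type*} [Group G]

/-- **F1** (XS).  A class `u U₁ ∈ U₀/U₁` fixing the double coset `A x U₁` comes from `Γ_x`:
`u ≡ x⁻¹ γ x (mod U₁)` for some `γ ∈ A` with `x⁻¹ γ x ∈ U₀`.  (`DoubleCoset.eq`.) -/
theorem exists_conj_mem_of_doubleCoset_mul_eq (A U₀ U₁ : Subgroup G) (hle : U₁ ≤ U₀)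
    {x u : G} (hu : u ∈ U₀)
    (h : DoubleCoset.mk A U₁ (x * u) = DoubleCoset.mk A U₁ x) :
    ∃ γ ∈ A, x⁻¹ * γ * x ∈ U₀ ∧ (x⁻¹ * γ * x)⁻¹ * u ∈ U₁ := by
  sorry

/-- **F1′** (XS).  Conversely `x⁻¹ Γ_x x` fixes `A x U₁`. -/
theorem doubleCoset_mul_conj_eq (A U₁ : Subgroup G) (x : G) {γ : G} (hγ : γ ∈ A) :
    DoubleCoset.mk A U₁ (x * (x⁻¹ * γ * x)) = DoubleCoset.mk A U₁ x := by
  sorry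

/-- **F1″** (XS, plumbing).  Right translation by `U₀` is well defined on `A \ G / U₁` when `U₁` is
normal in `U₀` — this is what makes `Δ = U₀/U₁` ACT on `X`. -/
theorem doubleCoset_mul_eq_of_eq (A U₀ U₁ : Subgroup G) (hle : U₁ ≤ U₀)
    (hnorm : ∀ u ∈ U₀, ∀ k ∈ U₁, u⁻¹ * k * u ∈ U₁) {x y u : G} (hu : u ∈ U₀)
    (h : DoubleCoset.mk A U₁ x = DoubleCoset.mk A U₁ y) :
    DoubleCoset.mk A U₁ (x * u) = DoubleCoset.mk A U₁ (y * u) := by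
  sorry

/-- **F2** (XS).  A subgroup of order dividing `m` in a finite group of order coprime to `m` is
trivial (Lagrange). -/
theorem eq_bot_of_card_dvd_of_coprime {Δ : Type*} [Group Δ] [Finite Δ] (H : Subgroup Δ) {m : ℕ}
    (hH : Nat.card H ∣ m) (hcop : (Nat.card Δ).Coprime m) : H = ⊥ := by
  sorry

/-- **F2₅** (XS).  The case used: `Δ` a `5`-group, `Nat.card H ∣ 24` (the Brandt bound), `5 ∤ 24`. -/
theorem eq_bot_of_card_dvd_twentyfour_of_isPGroup_five {Δ : Type*} [Group Δ] [Finite Δ]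
    (hΔ : IsPGroup 5 Δ) (H : Subgroup Δ) (hH : Nat.card H ∣ 24) : H = ⊥ := by
  sorry

example : Nat.Coprime 24 5 := by decide
example : ¬ 5 ∣ 24 := by decide
/- at `ℓ = 3` the tool FAILS: `3 ∣ 24`, `3 ∣ 12` (`B_{2,∞}`: `|O^×| = 24`; `B_{3,∞}`: `12`). -/
example : 3 ∣ 24 := by decide

variable {Δ X : Type*} [Group Δ] [MulAction Δ X]

/-- **F3** (S).  A free action is equivariantly a product `X ≃ X/Δ × Δ`
(`MulAction.orbitEquivQuotientStabilizer` orbitwise + a choice of orbit representatives). -/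
theorem exists_equiv_prod_of_stabilizer_eq_bot
    (hfree : ∀ x : X, MulAction.stabilizer Δ x = ⊥) :
    ∃ e : X ≃ MulAction.orbitRel.Quotient Δ X × Δ,
      ∀ (δ : Δ) (x : X), e (δ • x) = ((e x).1, δ * (e x).2) := by
  sorry

/-- **F4** (S).  Hence `R`-valued functions on `X` are a FREE module over the group ring, in
coordinates: `(X → R) ≃ₗ[R] (X/Δ → Δ → R)` carrying translation by `δ` to `d ↦ δ⁻¹ d` on the
`Δ`-coordinate (= `|X/Δ|` copies of the regular representation).  This is Taylor 2006 Lemma 2.3(2)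
("`S(U_{1,Σ})` is a free `O[Δ_Σ]`-module") with the dimension count replaced by an explicit basis. -/
theorem exists_linearEquiv_of_stabilizer_eq_bot (R : Type*) [CommRing R]
    (hfree : ∀ x : X, MulAction.stabilizer Δ x = ⊥) :
    ∃ e : (X → R) ≃ₗ[R] (MulAction.orbitRel.Quotient Δ X → Δ → R),
      ∀ (f : X → R) (δ : Δ) (q : MulAction.orbitRel.Quotient Δ X) (d : Δ),
        e (fun x => f (δ⁻¹ • x)) q d = e f q (δ⁻¹ * d) := by
  sorry

/-- **F5a** (XS).  Invariants = functions on the orbit space (no freeness): `S(U₀) = S(U₁)^Δ`. -/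
theorem exists_equiv_invariants (R : Type*) :
    ∃ e : {f : X → R // ∀ (δ : Δ) (x : X), f (δ • x) = f x} ≃
        (MulAction.orbitRel.Quotient Δ X → R),
      ∀ (f : {f : X → R // ∀ (δ : Δ) (x : X), f (δ • x) = f x}) (x : X),
        e f (Quotient.mk (MulAction.orbitRel Δ X) x) = f.1 x := by
  sorry

/-- **F5b** (S).  Under freeness and `Δ` finite the norm `f ↦ (x ↦ ∑_δ f (δ⁻¹ • x))` maps ONTO the
invariants — Taylor 2006 Lemma 2.3(1): `∑_{h ∈ Δ_Σ} h : S(U_{1,Σ})_{Δ_Σ} ⥲ S(U_{0,Σ})`, the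
"`M_{Q,Δ_Q} ≅ M_∅`" input of every patching datum (g12 `RTDatum`). -/
theorem exists_sum_smul_eq_of_stabilizer_eq_bot [Fintype Δ] (R : Type*) [AddCommMonoid R]
    (hfree : ∀ x : X, MulAction.stabilizer Δ x = ⊥) (g : X → R)
    (hg : ∀ (δ : Δ) (x : X), g (δ • x) = g x) :
    ∃ f : X → R, ∀ x : X, (∑ δ : Δ, f (δ⁻¹ • x)) = g x := by
  sorry

end Freeness

/-! ## §E  Consumer side: case B of `isModular_freyCurve_of_stubs` always has a multiplicative
prime `r ∉ {2, 5}` (so `D = B_{r,∞}` exists and is split at `5`) — elementary + LANDED theorems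
`stub_freyCaseBSixteen`, `exists_normalised_freyCurve_caseB`, `isModular_freyCurve_of_natAbs_eq_two`. -/

section Consumer

/-- **E1** (S).  The `{2,5}`-unit equation: if `a, b` are coprime, `ab(a+b) ≠ 0` and every prime
factor of `ab(a+b)` is `2` or `5`, then `|ab(a+b)| ∈ {2, 20}` (types `1+1=2` and `1+4=5`).
Proof: exactly one of `a, b, a+b` is even; `5^j + 1 = 2^i ⇒ (i,j) = (1,0)`; `2^i + 1 = 5^j ⇒
(i,j) = (2,1)` (mod 8 forces `j` even for `i ≥ 3`, then `(5^k-1)(5^k+1) = 2^i` is impossible). -/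
theorem natAbs_eq_two_or_twenty_of_prime_factors_subset {a b : ℤ} (hab : IsCoprime a b)
    (h0 : a * b * (a + b) ≠ 0)
    (hS : ∀ p : ℕ, p.Prime → (p : ℤ) ∣ a * b * (a + b) → p = 2 ∨ p = 5) :
    (a * b * (a + b)).natAbs = 2 ∨ (a * b * (a + b)).natAbs = 20 := by
  sorry

/-- **E2** (XS).  The tree's case-B normalisation `exists_normalised_freyCurve_caseB`
(Diamond–Kramer Lemma 1: translation / swap / `−1`-twist) preserves `|ab(a+b)|` — re-run its proof
carrying the extra conjunct. [cite: DiamondKramer1995, Lemma 1] -/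
theorem exists_normalised_freyCurve_caseB_natAbs {a b : ℤ} (hab : IsCoprime a b)
    (h0 : a * b * (a + b) ≠ 0)
    (hB : ∀ ρ₃ : ModPGaloisRep ℚ (ZMod 3) 2, (freyCurve a b).IsTorsionGaloisRep 3 ρ₃ →
      ¬ ρ₃.IsAbsIrreducibleOverSqrt (-3)) :
    ∃ A B : ℤ, IsCoprime A B ∧ A * B * (A + B) ≠ 0 ∧ A ≡ -1 [ZMOD 4] ∧ (2 : ℤ) ∣ B ∧
      (∀ ρ₃ : ModPGaloisRep ℚ (ZMod 3) 2, (freyCurve A B).IsTorsionGaloisRep 3 ρ₃ →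
        ¬ ρ₃.IsAbsIrreducibleOverSqrt (-3)) ∧
      (A * B * (A + B)).natAbs = (a * b * (a + b)).natAbs := by
  sorry

/-- **E3** (S).  THE DISCHARGE: a Frey curve in case B with `|ab(a+b)| ≠ 2` (the CM corner, already
`BCDT.IsModular` by `isModular_freyCurve_of_natAbs_eq_two`) has a prime `r ≠ 5` with `r ‖ N`.
From E1/E2: `|ab(a+b)| = 20` would normalise to `2 ∣ B`, `|AB(A+B)| = 20`, so `16 ∤ B`, against
`stub_freyCaseBSixteen`; hence a prime `r ∉ {2,5}` divides `ab(a+b)`, and `r ∣ rad ∣ 2N`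
(`radical_natAbs_dvd_two_mul_conductorNorm_freyCurve`), `r² ∤ N` since `N ∣ 2⁸·rad`
(`conductorNorm_freyCurve_dvd_holds`) and `rad` is squarefree. -/
theorem exists_prime_ne_five_dvd_conductorNorm_freyCurve_of_caseB {a b : ℤ} (hab : IsCoprime a b)
    (h0 : a * b * (a + b) ≠ 0) (h2 : (a * b * (a + b)).natAbs ≠ 2)
    (hB : ∀ ρ₃ : ModPGaloisRep ℚ (ZMod 3) 2, (freyCurve a b).IsTorsionGaloisRep 3 ρ₃ →
      ¬ ρ₃.IsAbsIrreducibleOverSqrt (-3)) :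
    ∃ r : ℕ, r.Prime ∧ r ≠ 5 ∧ r ∣ (freyCurve a b).conductorNorm ℤ ∧
      ¬ r ^ 2 ∣ (freyCurve a b).conductorNorm ℤ := by
  sorry

end Consumer

/-! ## §R  The regime-M re-cut of the stub (keeps `FreyModularity_of` intact) -/

section Recut

/-- VERBATIM statement of the registered stub `stub_liftFive` (Lines/Sketch.lean:170). -/
def StubLiftFive : Prop :=
  ∀ (W : WeierstrassCurve ℚ) [W.IsElliptic] (ρ : ModPGaloisRep ℚ (ZMod 5) 2),
    W.IsTorsionGaloisRep 5 ρ → ρ.IsAbsIrreducibleOverSqrt 5 → ¬ 25 ∣ W.conductorNorm ℤ →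
    ρ.IsModular → W.IsModularGaloisRepTate 5

/-- **R-M** — `stub_liftFive` restricted to REGIME M: `W` has a prime `r ≠ 5` of multiplicative
reduction (`r ‖ N`), i.e. `π_{W,r}` is Steinberg and the eigen-system transfers to the definite
quaternion algebra `B_{r,∞}` (split at `5`).  Contains every consumer instance (§E, E3). -/
def StubLiftFiveMult : Prop :=
  ∀ (W : WeierstrassCurve ℚ) [W.IsElliptic] (ρ : ModPGaloisRep ℚ (ZMod 5) 2),
    W.IsTorsionGaloisRep 5 ρ → ρ.IsAbsIrreducibleOverSqrt 5 → ¬ 25 ∣ W.conductorNorm ℤ →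
    (∃ r : ℕ, r.Prime ∧ r ≠ 5 ∧ r ∣ W.conductorNorm ℤ ∧ ¬ r ^ 2 ∣ W.conductorNorm ℤ) →
    ρ.IsModular → W.IsModularGaloisRepTate 5

/-- R-M is a WEAKENING of the stub (so every closer of the stub closes it). -/
theorem stubLiftFiveMult_of_stubLiftFive (h : StubLiftFive) : StubLiftFiveMult :=
  fun W _ ρ hρ hirr h25 _ hmod ↦ h W ρ hρ hirr h25 hmod

/-- **Consumer glue for the re-cut** — `liftFive_of_stubs` (Lines/Sketch.lean:543) with the regime
binder threaded through; `isModular_freyCurve_of_stubs` case B feeds it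
`exists_prime_ne_five_dvd_conductorNorm_freyCurve_of_caseB` after branching off `|ab(a+b)| = 2`
(`isModular_freyCurve_of_natAbs_eq_two`).  PROVED (one line, as in the skeleton). -/
theorem liftFive_of_stubs_mult (hlift5 : StubLiftFiveMult)
    (h32 : ∀ (W : WeierstrassCurve ℚ) [W.IsElliptic] [NeZero (W.conductorNorm ℤ)] (ℓ : ℕ)
      [Fact ℓ.Prime], W.IsModularGaloisRepTate ℓ → BCDT.IsModular W) :
    ∀ (W : WeierstrassCurve ℚ) [W.IsElliptic] [NeZero (W.conductorNorm ℤ)],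
      ¬ 25 ∣ W.conductorNorm ℤ →
      (∃ r : ℕ, r.Prime ∧ r ≠ 5 ∧ r ∣ W.conductorNorm ℤ ∧ ¬ r ^ 2 ∣ W.conductorNorm ℤ) →
      ∀ (ρ : ModPGaloisRep ℚ (ZMod 5) 2), W.IsTorsionGaloisRep 5 ρ →
      ρ.IsAbsIrreducibleOverSqrt 5 → ρ.IsModular → BCDT.IsModular W :=
  fun W _ _ h25 hr ρ hρ hirr hmod ↦ h32 W 5 (hlift5 W ρ hρ hirr h25 hr hmod)

/-- **Case-B consumer, re-cut** (shape check, PROVED): with the re-cut glue, the CM corner and E3,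
case B of a Frey curve still yields `BCDT.IsModular` — the three inputs it needs beyond the
skeleton's are exactly `hcorner` (tree: `isModular_freyCurve_of_natAbs_eq_two`), `hE3` (E3) and
the re-cut `h2`. -/
theorem isModular_freyCurve_caseB_recut {a b : ℤ} (hab : IsCoprime a b) (h0 : a * b * (a + b) ≠ 0)
    [NeZero ((freyCurve a b).conductorNorm ℤ)]
    (hB : ∀ ρ₃ : ModPGaloisRep ℚ (ZMod 3) 2, (freyCurve a b).IsTorsionGaloisRep 3 ρ₃ →
      ¬ ρ₃.IsAbsIrreducibleOverSqrt (-3))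
    (hcorner : (a * b * (a + b)).natAbs = 2 → BCDT.IsModular (freyCurve a b))
    (hE3 : (a * b * (a + b)).natAbs ≠ 2 →
      (∀ ρ₃ : ModPGaloisRep ℚ (ZMod 3) 2, (freyCurve a b).IsTorsionGaloisRep 3 ρ₃ →
        ¬ ρ₃.IsAbsIrreducibleOverSqrt (-3)) →
      ∃ r : ℕ, r.Prime ∧ r ≠ 5 ∧ r ∣ (freyCurve a b).conductorNorm ℤ ∧
        ¬ r ^ 2 ∣ (freyCurve a b).conductorNorm ℤ)
    (h2 : ∀ (W : WeierstrassCurve ℚ) [W.IsElliptic] [NeZero (W.conductorNorm ℤ)],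
      ¬ 25 ∣ W.conductorNorm ℤ →
      (∃ r : ℕ, r.Prime ∧ r ≠ 5 ∧ r ∣ W.conductorNorm ℤ ∧ ¬ r ^ 2 ∣ W.conductorNorm ℤ) →
      ∀ (ρ : ModPGaloisRep ℚ (ZMod 5) 2), W.IsTorsionGaloisRep 5 ρ →
      ρ.IsAbsIrreducibleOverSqrt 5 → ρ.IsModular → BCDT.IsModular W)
    (h25 : ¬ 25 ∣ (freyCurve a b).conductorNorm ℤ)
    (ρ : ModPGaloisRep ℚ (ZMod 5) 2) (hρ : (freyCurve a b).IsTorsionGaloisRep 5 ρ)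
    (h5 : ρ.IsAbsIrreducibleOverSqrt 5) (hρmod : ρ.IsModular) :
    BCDT.IsModular (freyCurve a b) := by
  haveI := isElliptic_freyCurve h0
  by_cases hc : (a * b * (a + b)).natAbs = 2
  · exact hcorner hc
  · exact h2 (freyCurve a b) h25 (hE3 hc hB) ρ hρ h5 hρmod

end Recut

end Summit.ABC.ABC.Cruxes.FreyModularity.StubIdeas.LiftFive2g17
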